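import Summits.Ventures.HodgeRepro2.T6N41PlaceSatakeHyp
import Summits.Ventures.HodgeRepro2.T6N41PlaceKappaMain

/-!
# T6N41PlaceSatakeMain — the compat field `BCχ_eq` as a theorem, and the placement (P7) over the core (Tier 6, M2; proof lane; owner t6-p4)

`BCχ_eq_of_satake`: over the core `C : InertData Pl` and the Satake layer `Sd : SatakeDatum C`, from the three
displays — Rogawski §4.5 (`Hyp.Rogawski1990_Sec4_5_Unramified`: the unramified constituent determines `χ` up
to `Ω(T, G)`), Harris II (2.2.5)(b) and Rogawski §11.4 (their core forms) — the identity that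
`T6N41PlaceInert` carried as the compat field `InertDatum.BCχ_eq`: at every inert prime `𝔓` off `S`,
`Pl.BCχ 𝔓 = twist (BCrog π_v) (ξV 𝔓)`.  The proof: Harris puts `π_v` in `JH(I(χ′/χ))` with `(χ′/χ)(ϖ) = −1`
(F3); `π_v` is unramified (`π_unr`) and lies in `JH(i_G(χ_{sat}))` (`sat_spec`), so Rogawski §4.5 gives
`sat π_v ∈ {−1, (−1)⁻¹} = {−1}`; LR's definition read through the transfer (`BC_sat`) gives
`BC(π_v) = π(−1, (−1)⁻¹)`; Rogawski §11.4 gives `ρ̃ = π(−1, (−1)⁻¹)` for the member `π_v` of the packet; the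
twist by `χ_V` (`BCχ_def`) on both sides closes.

`inertDatum_of_satake`: the `InertDatum` built from `C` by `InertData.toDatum` with that theorem as its
`BCχ_eq` — every landed consumer (`N41_placement_inert`, the split and κ layers, `N41_placement_kappa`, the
universal chain, the N4 assembly) is reached from binders in which the class-IR identification «two base
changes agree» no longer occurs: `N41_placement_kappa_satake` = the placement (P7) with κ, over the core, the
Satake layer and the EIGHT displays (the seven of `N41_placement_kappa` + Rogawski §4.5).
`#print axioms` = {propext, Classical.choice, Quot.sound}.

§8(d): uses an L-value-free non-vanishing device: NO.
-/

namespace Summit.Ventures.HodgeRepro2.T6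
namespace N41Place

variable {ι : Type*} {D : DoublingLDatum ι} {Pl : PlacementDatum D}

/-- The landed Harris II display on `C.toDatum h` IS its core form (the statements coincide for every `h`). -/
theorem harris_toDatum (C : InertData Pl)
    (h : ∀ 𝔓, C.inert 𝔓 → Pl.b 𝔓 ∉ D.S → Pl.BCχ 𝔓 = C.twist 𝔓 (C.BCrog 𝔓 (C.π (Pl.b 𝔓))) (C.ξV 𝔓)) :
    Hyp.HarrisII2007_Prop2_2_5_b (C.toDatum h) ↔ Hyp.HarrisII2007_Prop2_2_5_b_core C := Iff.rfl

/-- The landed Rogawski §11.4 display on `C.toDatum h` IS its core form. -/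
theorem rogawski_toDatum (C : InertData Pl)
    (h : ∀ 𝔓, C.inert 𝔓 → Pl.b 𝔓 ∉ D.S → Pl.BCχ 𝔓 = C.twist 𝔓 (C.BCrog 𝔓 (C.π (Pl.b 𝔓))) (C.ξV 𝔓)) :
    Hyp.Rogawski1990_Sec11_4_BC (C.toDatum h) ↔ Hyp.Rogawski1990_Sec11_4_BC_core C := Iff.rfl

/-- **The compat field `BCχ_eq` as a theorem.**  Over the core `C` and its Satake layer `Sd`, from Rogawski §4.5
(`hSat`), Harris II (2.2.5)(b) (`hHa`) and Rogawski §11.4 (`hRo`): at every inert prime off `S`, LR's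
`BC(π_v) ⊗ χ_{V,v}` is Rogawski's lift of `π_v` twisted by `χ_{V,v}`. -/
theorem BCχ_eq_of_satake (C : InertData Pl) (Sd : SatakeDatum C)
    (hSat : Hyp.Rogawski1990_Sec4_5_Unramified Sd)
    (hHa : Hyp.HarrisII2007_Prop2_2_5_b_core C) (hRo : Hyp.Rogawski1990_Sec11_4_BC_core C) :
    ∀ 𝔓, C.inert 𝔓 → Pl.b 𝔓 ∉ D.S → Pl.BCχ 𝔓 = C.twist 𝔓 (C.BCrog 𝔓 (C.π (Pl.b 𝔓))) (C.ξV 𝔓) := by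
  intro 𝔓 hi hS
  -- F3: `(χ′/χ)(ϖ) = −1`
  have hχ : C.χHarris 𝔓 = -1 := C.χHarris_eq 𝔓 hi hS
  -- Harris: `π_v ∈ JH(I(χ′/χ))`
  have hmem : C.π (Pl.b 𝔓) ∈ C.JH 𝔓 (C.χHarris 𝔓) :=
    hHa 𝔓 hi hS (C.thetaLift_all _) (C.βTrivial_of 𝔓 hi hS)
  -- `π_v` is unramified and lies in `JH(i_G(χ_sat))`
  have hunr : Sd.unr 𝔓 (C.π (Pl.b 𝔓)) := Sd.π_unr 𝔓 hi hS
  have hsat : C.π (Pl.b 𝔓) ∈ C.JH 𝔓 (Sd.sat 𝔓 (C.π (Pl.b 𝔓))) := Sd.sat_spec 𝔓 _ hunr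
  -- Rogawski §4.5: `sat π_v ∈ {χ′/χ, (χ′/χ)⁻¹}`, both `−1`
  have hW := hSat 𝔓 hi (C.χHarris 𝔓) (Sd.sat 𝔓 (C.π (Pl.b 𝔓))) _ hunr hmem hsat
  have hsat1 : Sd.sat 𝔓 (C.π (Pl.b 𝔓)) = -1 := by
    rcases hW with h | h
    · rw [h, hχ]
    · rw [h, hχ]
      simp
  -- Rogawski §11.4 on the unitary value `−1`
  have hunit : ‖((C.χHarris 𝔓 : ℂˣ) : ℂ)‖ = 1 := by
    rw [hχ]
    simp
  have hBC : C.BCrog 𝔓 (C.π (Pl.b 𝔓)) = Pl.ps 𝔓 (C.χHarris 𝔓) (C.χHarris 𝔓)⁻¹ :=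
    hRo 𝔓 hi (C.χHarris 𝔓) hunit _ hmem
  -- LR's definition through the transfer, and the twist on both sides
  rw [Sd.BCχ_def 𝔓 hi, Sd.BC_sat 𝔓 hi hS, hsat1, hBC, hχ]
  rfl

/-- The inert datum over the core `C` whose compat field is the THEOREM `BCχ_eq_of_satake`. -/
def inertDatum_of_satake (C : InertData Pl) (Sd : SatakeDatum C)
    (hSat : Hyp.Rogawski1990_Sec4_5_Unramified Sd)
    (hHa : Hyp.HarrisII2007_Prop2_2_5_b_core C) (hRo : Hyp.Rogawski1990_Sec11_4_BC_core C) :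
    InertDatum Pl :=
  C.toDatum (BCχ_eq_of_satake C Sd hSat hHa hRo)

/-- The core of `inertDatum_of_satake` is `C`. -/
theorem toData_inertDatum_of_satake (C : InertData Pl) (Sd : SatakeDatum C)
    (hSat : Hyp.Rogawski1990_Sec4_5_Unramified Sd)
    (hHa : Hyp.HarrisII2007_Prop2_2_5_b_core C) (hRo : Hyp.Rogawski1990_Sec11_4_BC_core C) :
    (inertDatum_of_satake C Sd hSat hHa hRo).toData = C := rfl

/-- Harris II (2.2.5)(b) holds on `inertDatum_of_satake` (it is the core form). -/
theorem harris_of_satake (C : InertData Pl) (Sd : SatakeDatum C)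
    (hSat : Hyp.Rogawski1990_Sec4_5_Unramified Sd)
    (hHa : Hyp.HarrisII2007_Prop2_2_5_b_core C) (hRo : Hyp.Rogawski1990_Sec11_4_BC_core C) :
    Hyp.HarrisII2007_Prop2_2_5_b (inertDatum_of_satake C Sd hSat hHa hRo) := hHa

/-- Rogawski §11.4 holds on `inertDatum_of_satake` (it is the core form). -/
theorem rogawski_of_satake (C : InertData Pl) (Sd : SatakeDatum C)
    (hSat : Hyp.Rogawski1990_Sec4_5_Unramified Sd)
    (hHa : Hyp.HarrisII2007_Prop2_2_5_b_core C) (hRo : Hyp.Rogawski1990_Sec11_4_BC_core C) :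
    Hyp.Rogawski1990_Sec11_4_BC (inertDatum_of_satake C Sd hSat hHa hRo) := hRo

/-- **The Satake identity at the inert places over the core** — `satake_inert` on `inertDatum_of_satake`: the
binders are the core, the Satake layer and the three displays; no compat field. -/
theorem satake_inert_of_satake (C : InertData Pl) (Sd : SatakeDatum C)
    (hSat : Hyp.Rogawski1990_Sec4_5_Unramified Sd)
    (hHa : Hyp.HarrisII2007_Prop2_2_5_b_core C) (hRo : Hyp.Rogawski1990_Sec11_4_BC_core C) :
    ∀ 𝔓, C.inert 𝔓 → Pl.b 𝔓 ∉ D.S →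
      (Pl.α 𝔓 = Pl.η₁ 𝔓 ∧ Pl.β 𝔓 = Pl.η₂ 𝔓) ∨ (Pl.α 𝔓 = Pl.η₂ 𝔓 ∧ Pl.β 𝔓 = Pl.η₁ 𝔓) :=
  satake_inert (inertDatum_of_satake C Sd hSat hHa hRo) (harris_of_satake C Sd hSat hHa hRo)
    (rogawski_of_satake C Sd hSat hHa hRo)

/-- **The placement (P7) with κ, over the core.**  `N41_placement_kappa` on `inertDatum_of_satake`: binders =
the core `C`, the Satake layer `Sd`, the split / Langlands-quotient / convention data over it, the EIGHT
displays by name (Lapid–Rallis §7, Bump (5.22), Rogawski §4.5, Harris II (2.2.5)(b), Rogawski §11.4, Mínguez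
Thm 1 (2), Bump Thm 4.5.1, Rao Cor. A.5 (1)), the dichotomy `hdich` and the residual `hκ'` — the compat field
`BCχ_eq` is not among them. -/
theorem N41_placement_kappa_satake (D : DoublingLDatum ι) (Pl : PlacementDatum D)
    (C : InertData Pl) (Sd : SatakeDatum C)
    (hSat : Hyp.Rogawski1990_Sec4_5_Unramified Sd)
    (hHa : Hyp.HarrisII2007_Prop2_2_5_b_core C) (hRo : Hyp.Rogawski1990_Sec11_4_BC_core C)
    (Sp : SplitDatum (inertDatum_of_satake C Sd hSat hHa hRo)) (L : SplitLQ Sp) (Kd : KappaDatum Sp)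
    (hLR7 : Hyp.LapidRallis2005_Sec7_Unramified D Pl) (hB : Hyp.Bump1997_5_22 Pl)
    (hM : Hyp.Minguez2008_Thm1_2_LQ L) (hB451 : Hyp.Bump1997_Thm4_5_1 L)
    (hRao : Hyp.Rao1993_CorA5_1 Kd)
    (hdich : ∀ 𝔓, Pl.b 𝔓 ∉ D.S → C.inert 𝔓 ∨ Sp.splitPlace (Pl.b 𝔓))
    -- [residual: AD — TIER5 §N4.1.10 Lemma A′-4 (b4)–(b6), the local convention identity `κ_v(ϖ_v) = κ′(ϖ_v)⁻¹`]
    (hκ' : ∀ v, Sp.splitPlace v → v ∉ D.S → Kd.κv v = (Kd.κ' v)⁻¹) :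
    ∀ v ∉ D.S, ∀ s : ℂ, D.Lv v s = D.g₁ v s * D.g₂ v s :=
  N41_placement_kappa D Pl (inertDatum_of_satake C Sd hSat hHa hRo) Sp L Kd hLR7 hB
    (harris_of_satake C Sd hSat hHa hRo) (rogawski_of_satake C Sd hSat hHa hRo) hM hB451 hRao hdich hκ'

end N41Place
end Summit.Ventures.HodgeRepro2.T6
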